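import Literature.NumberTheory.LFunctions.LittlewoodZeroGapsProofs
import HarnessLib

/-!
# Littlewood's theorem on the gaps between zero ordinates of `ζ` — the quantitative form (Titchmarsh Thm 9.12)

Trunk T-ANT (`Literature/NumberTheory/LFunctions`).  Titchmarsh, *The Theory of the Riemann Zeta-Function*, 2nd ed.,
Theorem 9.12 (Littlewood 1924): «for every large positive `T`, `ζ(s)` has a zero `β + iγ` satisfying
`|γ − T| < A / log log log T`».  The chain-of-circles proof of `LittlewoodZeroGapsProofs.lean` is run with the number of
circles `n` depending on `T`: the chain (`LittlewoodZeroGapsChain.chain`, `n h = 7/2`) forces a zero within `4h = 14/n` of `T`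
as soon as `(4·8^{n+2})^{1/bⁿ} ≤ log T` (`b = 1 − log 2/log 3 ≥ 1/3`), and `n = ⌊log log log T / 4⌋` qualifies because
`3ⁿ · log(4·8^{n+2}) ≤ 3ⁿ · 3(n+3) ≤ 27ⁿ ≤ e^{4n} ≤ log log T`.  We obtain the printed statement with the (immaterial) constant `A = 112`.

* `LittlewoodZeroGaps.exists_zero_im_near_of_rpow_le_log` — the parametric step: `n ≥ 28`, `T ≥ 8`, `log T ≥ 21`,
  `(4·8^{n+2})^{1/bⁿ} ≤ log T` ⟹ a zero `ρ` of `ζ` with `|Im ρ − T| ≤ 14/n`, `0 < Re ρ < 1`;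
* `LittlewoodZeroGaps.exists_zero_im_near_logloglog` — `∃ T₀, ∀ T ≥ T₀, ∃ ρ, ζ ρ = 0 ∧ |Im ρ − T| ≤ 112 / log log log T ∧ 0 < Re ρ < 1`;
* `littlewood_zero_near_every_height` — the same with `ρ ∈ ZetaZeros.riemannZetaNontrivialZeros` (Thm 9.12 as printed, `A = 112`).

Sorry-free, standard axioms; no instances, no notation.  Provenance: cell rh-split, seat rh-split-typer-2 g4.
-/

noncomputable section

open Complex Metric Set Real Filter Topology

namespace Literature.NumberTheory.LFunctions

namespace LittlewoodZeroGaps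

/-- **The parametric step of Titchmarsh §9.12:** if `n ≥ 28`, `T ≥ 8`, `log T ≥ 21` and `(4·8^{n+2})^{1/bⁿ} ≤ log T`
(`b = 1 − log 2/log 3`), then `ζ` has a zero `ρ` with `|Im ρ − T| ≤ 14/n` (and `0 < Re ρ < 1`): otherwise the box
`−1 ≤ σ ≤ 4`, `|t − T| ≤ 14/n = 4h` is zero-free and the chain of circles bounds `‖log ζ(−1/2 + iT)‖` by `log(T+5)/4`,
against `log ‖ζ(−1/2 + iT)‖ ≥ log T − 9`. [cite: Titchmarsh1986, §9.12] -/
theorem exists_zero_im_near_of_rpow_le_log {T : ℝ} {n : ℕ} (hn28 : (28 : ℝ) ≤ n) (hT8 : 8 ≤ T)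
    (h21 : 21 ≤ Real.log T)
    (hC : (4 * (8 : ℝ) ^ (n + 2)) ^ (1 / (1 - Real.log 2 / Real.log 3) ^ n) ≤ Real.log T) :
    ∃ ρ : ℂ, riemannZeta ρ = 0 ∧ |ρ.im - T| ≤ 14 / n ∧ 0 < ρ.re ∧ ρ.re < 1 := by
  have hn0 : (0 : ℝ) < n := by linarith
  obtain ⟨h, hhdef⟩ : ∃ h : ℝ, h = 7 / (2 * n) := ⟨_, rfl⟩
  have hh : 0 < h := by rw [hhdef]; positivity
  have hnh : (n : ℝ) * h = 7 / 2 := by rw [hhdef]; field_simp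
  have hh8 : h ≤ 1 / 8 := by
    rw [hhdef, div_le_iff₀ (by positivity)]; linarith
  have h4n : 4 * h = 14 / n := by rw [hhdef]; field_simp; ring
  -- the exponent `b` and the constant `C`
  obtain ⟨b, hbdef⟩ : ∃ b : ℝ, b = 1 - Real.log 2 / Real.log 3 := ⟨_, rfl⟩
  have hb : 0 < b ∧ b < 1 := by rw [hbdef]; exact b_pos_lt_one
  have hbn : 0 < b ^ n := pow_pos hb.1 n
  have hbn1 : b ^ n ≤ 1 := pow_le_one₀ hb.1.le hb.2.le
  obtain ⟨C, hCdef⟩ : ∃ C : ℝ, C = 4 * (8 : ℝ) ^ (n + 2) := ⟨_, rfl⟩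
  have hC0 : 0 < C := by rw [hCdef]; positivity
  have hClog : C ^ (1 / b ^ n) ≤ Real.log T := by rw [hCdef, hbdef]; exact hC
  have hT0 : 0 < T := by linarith
  by_contra hno
  push Not at hno
  -- zero-freeness of the box
  have hzf : ∀ z : ℂ, -1 ≤ z.re → z.re ≤ 4 → |z.im - T| ≤ 4 * h → riemannZeta z ≠ 0 := by
    intro z _ _ hz h0
    have him : z.im ≠ 0 := by
      have := neg_abs_le (z.im - T)
      intro him; linarith
    obtain ⟨h1, h2⟩ := re_mem_Ioo_of_riemannZeta_eq_zero_of_im_ne_zero h0 him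
    exact absurd h2 (not_lt.2 (hno z h0 (hz.trans h4n.le) h1))
  -- the chain at `ν = n`: centre `-1/2 + iT`
  obtain ⟨L, hLd, -, hLexp, -, hL2⟩ := chain hT8 hh hh8 hnh hzf n le_rfl
  have hcn : ((3 - (n : ℕ) * h : ℝ) : ℂ) + T * I = -1 / 2 + T * I := by
    have : (3 - (n : ℝ) * h) = -1 / 2 := by rw [hnh]; norm_num
    rw [this]; push_cast; ring
  have h4h : (0 : ℝ) < 4 * h := by positivity
  have hcmem : ((3 - (n : ℕ) * h : ℝ) : ℂ) + T * I ∈ ball (((3 - (n : ℕ) * h : ℝ) : ℂ) + T * I) (4 * h) :=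
    mem_ball_self h4h
  -- upper bound at the centre
  set K : ℝ := (8 : ℝ) ^ (n + 1) * (3 * Real.log (T + 5) + 2) with hK
  have hup : ‖L (-1 / 2 + T * I)‖ ≤ (2 : ℝ) ^ (b ^ n) * K ^ (1 - b ^ n) := by
    have := hL2 (((3 - (n : ℕ) * h : ℝ) : ℂ) + T * I) (by simp; positivity)
    rw [hcn] at this; rw [hbdef]; exact this
  -- lower bound at the centre
  have hlow : Real.log T - 9 ≤ ‖L (-1 / 2 + T * I)‖ := by
    have hre : (L (-1 / 2 + T * I)).re = Real.log ‖riemannZeta (-1 / 2 + T * I)‖ := by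
      have := hLexp _ hcmem
      rw [hcn] at this
      rw [← this, norm_exp, Real.log_exp]
    calc Real.log T - 9 ≤ Real.log ‖riemannZeta (-1 / 2 + T * I)‖ :=
          log_norm_zeta_neg_half_ge (by linarith)
      _ = (L (-1 / 2 + T * I)).re := hre.symm
      _ ≤ |(L (-1 / 2 + T * I)).re| := le_abs_self _
      _ ≤ ‖L (-1 / 2 + T * I)‖ := abs_re_le_norm _
  -- the real-variable contradiction
  set u : ℝ := Real.log (T + 5) with hu
  have hu_ge : Real.log T ≤ u := Real.log_le_log hT0 (by linarith)
  have hu_le : u ≤ Real.log T + 1 := by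
    have h2T : T + 5 ≤ 2 * T := by linarith
    calc u ≤ Real.log (2 * T) := Real.log_le_log (by linarith) h2T
      _ = Real.log 2 + Real.log T := Real.log_mul (by norm_num) hT0.ne'
      _ ≤ Real.log T + 1 := by linarith [Real.log_two_lt_d9]
  have hu21 : 21 ≤ u := by linarith
  have hu0 : 0 < u := by linarith
  -- `u^{b^n} ≥ C`
  have hubn : C ≤ u ^ (b ^ n) := by
    have h1 : C ^ (1 / b ^ n) ≤ u := hClog.trans hu_ge
    have h2 := Real.rpow_le_rpow (by positivity) h1 hbn.le
    rwa [← Real.rpow_mul hC0.le, one_div_mul_cancel hbn.ne', Real.rpow_one] at h2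
  -- `K ≤ 32 · 8^{n+1} · u`... : `K ≤ 8^{n+1} (4u)`
  have hK4 : K ≤ (8 : ℝ) ^ (n + 1) * 4 * u := by
    rw [hK]; nlinarith [pow_pos (by norm_num : (0:ℝ) < 8) (n + 1)]
  have hK0 : 0 < K := by rw [hK]; positivity
  have hX1 : (1 : ℝ) ≤ (8 : ℝ) ^ (n + 1) * 4 := by nlinarith [one_le_pow₀ (by norm_num : (1:ℝ) ≤ 8) (n := n + 1)]
  -- `K^{1-b^n} ≤ (8^{n+1}·4) · u^{1-b^n} = (8^{n+1}·4) · u / u^{b^n} ≤ (8^{n+1}·4) u / C = u/8... `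
  have hstep1 : K ^ (1 - b ^ n) ≤ ((8 : ℝ) ^ (n + 1) * 4 * u) ^ (1 - b ^ n) :=
    Real.rpow_le_rpow hK0.le hK4 (by linarith)
  have hstep2 : ((8 : ℝ) ^ (n + 1) * 4 * u) ^ (1 - b ^ n) ≤ (8 : ℝ) ^ (n + 1) * 4 * (u / C) := by
    rw [Real.mul_rpow (by positivity) hu0.le]
    have ha : ((8 : ℝ) ^ (n + 1) * 4) ^ (1 - b ^ n) ≤ (8 : ℝ) ^ (n + 1) * 4 := by
      calc ((8 : ℝ) ^ (n + 1) * 4) ^ (1 - b ^ n) ≤ ((8 : ℝ) ^ (n + 1) * 4) ^ (1 : ℝ) :=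
            Real.rpow_le_rpow_of_exponent_le hX1 (by linarith)
        _ = _ := Real.rpow_one _
    have hb' : u ^ (1 - b ^ n) ≤ u / C := by
      rw [Real.rpow_sub hu0, Real.rpow_one]
      exact div_le_div_of_nonneg_left hu0.le hC0 hubn
    exact mul_le_mul ha hb' (by positivity) (by positivity)
  have h2bn : (2 : ℝ) ^ (b ^ n) ≤ 2 := by
    calc (2 : ℝ) ^ (b ^ n) ≤ (2 : ℝ) ^ (1 : ℝ) := Real.rpow_le_rpow_of_exponent_le (by norm_num) hbn1
      _ = 2 := Real.rpow_one _
  have hfin : (2 : ℝ) ^ (b ^ n) * K ^ (1 - b ^ n) ≤ u / 4 := by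
    have hKpow0 : 0 ≤ K ^ (1 - b ^ n) := by positivity
    calc (2 : ℝ) ^ (b ^ n) * K ^ (1 - b ^ n) ≤ 2 * ((8 : ℝ) ^ (n + 1) * 4 * (u / C)) := by
          nlinarith [hstep1.trans hstep2]
      _ = u / 4 := by rw [hCdef]; field_simp; ring
  linarith

/-! ## Theorem 9.12 -/

/-- `b = 1 − log 2/log 3 ≥ 1/3` (i.e. `log 8 ≤ log 9`). [cite: Titchmarsh1986, §9.12] -/
theorem one_third_le_b : 1 / 3 ≤ 1 - Real.log 2 / Real.log 3 := by
  have h3 : 0 < Real.log 3 := Real.log_pos (by norm_num)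
  have h89 : Real.log 8 ≤ Real.log 9 := Real.log_le_log (by norm_num) (by norm_num)
  have h8 : Real.log 8 = 3 * Real.log 2 := by
    rw [show (8 : ℝ) = 2 ^ 3 by norm_num, Real.log_pow]; push_cast; ring
  have h9 : Real.log 9 = 2 * Real.log 3 := by
    rw [show (9 : ℝ) = 3 ^ 2 by norm_num, Real.log_pow]; push_cast; ring
  rw [h8, h9] at h89
  have : Real.log 2 / Real.log 3 ≤ 2 / 3 := by
    rw [div_le_div_iff₀ h3 (by norm_num)]; linarith
  linarith

/-- `27 ≤ e⁴`. [folklore] -/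
private theorem twentySeven_le_exp_four : (27 : ℝ) ≤ Real.exp 4 := by
  have h1 : (2.7182818283 : ℝ) < Real.exp 1 := Real.exp_one_gt_d9
  have h4 : Real.exp 4 = (Real.exp 1 ^ 2) ^ 2 := by rw [← pow_mul, ← Real.exp_nat_mul]; norm_num
  have e2 : (7 : ℝ) < Real.exp 1 ^ 2 := by nlinarith
  rw [h4]; nlinarith

/-- **Titchmarsh Thm 9.12 (Littlewood), with zeros as points:** there is `T₀` such that for every `T ≥ T₀` the zeta
function has a zero `ρ` with `|Im ρ − T| ≤ 112 / log log log T` (and `0 < Re ρ < 1`). [cite: Titchmarsh1986, Thm 9.12] -/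
theorem exists_zero_im_near_logloglog :
    ∃ T₀ : ℝ, ∀ T : ℝ, T₀ ≤ T →
      ∃ ρ : ℂ, riemannZeta ρ = 0 ∧ |ρ.im - T| ≤ 112 / Real.log (Real.log (Real.log T)) ∧
        0 < ρ.re ∧ ρ.re < 1 := by
  refine ⟨Real.exp (Real.exp (Real.exp 116)), fun T hT ↦ ?_⟩
  -- the three logarithms
  have he1 : (0 : ℝ) < Real.exp 116 := Real.exp_pos _
  have hT0 : 0 < T := (Real.exp_pos _).trans_le hT
  have hL1 : Real.exp (Real.exp 116) ≤ Real.log T := by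
    rw [Real.le_log_iff_exp_le hT0]; exact hT
  have hL1pos : 0 < Real.log T := (Real.exp_pos _).trans_le hL1
  have hL2 : Real.exp 116 ≤ Real.log (Real.log T) := by
    rw [Real.le_log_iff_exp_le hL1pos]; exact hL1
  have hL2pos : 0 < Real.log (Real.log T) := he1.trans_le hL2
  obtain ⟨L₃, hL₃def⟩ : ∃ L₃ : ℝ, L₃ = Real.log (Real.log (Real.log T)) := ⟨_, rfl⟩
  have hL3 : 116 ≤ L₃ := by
    rw [hL₃def, Real.le_log_iff_exp_le hL2pos]; exact hL2
  -- elementary size facts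
  have h116 : (116 : ℝ) ≤ Real.exp 116 := by linarith [Real.add_one_le_exp (116 : ℝ)]
  have h21 : 21 ≤ Real.log T := by linarith [Real.add_one_le_exp (Real.exp 116)]
  have hT8 : 8 ≤ T := by
    have := Real.add_one_le_exp (Real.exp (Real.exp 116))
    have h2 := Real.add_one_le_exp (Real.exp 116)
    linarith
  -- the number of circles
  obtain ⟨n, hndef⟩ : ∃ n : ℕ, n = ⌊L₃ / 4⌋₊ := ⟨_, rfl⟩
  have hL34 : 0 ≤ L₃ / 4 := by linarith
  have hnle : (n : ℝ) ≤ L₃ / 4 := by rw [hndef]; exact Nat.floor_le hL34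
  have hnge : L₃ / 4 - 1 ≤ n := by
    rw [hndef]; have := Nat.lt_floor_add_one (L₃ / 4); linarith
  have hn28 : (28 : ℝ) ≤ n := by linarith
  have hn0 : (0 : ℝ) < n := by linarith
  -- the growth condition `(4·8^{n+2})^{1/bⁿ} ≤ log T`
  obtain ⟨b, hbdef⟩ : ∃ b : ℝ, b = 1 - Real.log 2 / Real.log 3 := ⟨_, rfl⟩
  have hb : 0 < b ∧ b < 1 := by rw [hbdef]; exact b_pos_lt_one
  have hb3 : 1 / 3 ≤ b := by rw [hbdef]; exact one_third_le_b
  have hbn : 0 < b ^ n := pow_pos hb.1 n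
  obtain ⟨C, hCdef⟩ : ∃ C : ℝ, C = 4 * (8 : ℝ) ^ (n + 2) := ⟨_, rfl⟩
  have hC1 : 1 ≤ C := by
    rw [hCdef]; nlinarith [one_le_pow₀ (by norm_num : (1 : ℝ) ≤ 8) (n := n + 2)]
  have hC0 : 0 < C := by linarith
  -- `log C ≤ 3 (n + 3)`
  have hlogC : Real.log C ≤ 3 * (n + 3) := by
    have h8 : Real.log 8 ≤ 3 := by
      rw [Real.log_le_iff_le_exp (by norm_num)]
      have h3 : Real.exp 3 = Real.exp 1 ^ 3 := by rw [← Real.exp_nat_mul]; norm_num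
      have h2 : (2 : ℝ) ^ 3 ≤ Real.exp 1 ^ 3 :=
        pow_le_pow_left₀ (by norm_num) (by linarith [Real.exp_one_gt_d9]) 3
      rw [h3]; linarith
    have h4 : Real.log 4 ≤ 3 := by
      linarith [Real.log_le_log (by norm_num : (0:ℝ) < 4) (by norm_num : (4:ℝ) ≤ 8)]
    rw [hCdef, Real.log_mul (by norm_num) (by positivity), Real.log_pow]
    push_cast
    have hn2 : (0 : ℝ) ≤ (n : ℝ) + 2 := by positivity
    nlinarith [mul_le_mul_of_nonneg_left h8 hn2]
  -- `1/bⁿ ≤ 3ⁿ`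
  have hinv : 1 / b ^ n ≤ (3 : ℝ) ^ n := by
    rw [div_le_iff₀ hbn]
    have : (1 : ℝ) = (1 / 3 * 3) ^ n := by norm_num
    calc (1 : ℝ) = (1 / 3) ^ n * 3 ^ n := by rw [← mul_pow]; norm_num
      _ ≤ b ^ n * 3 ^ n := by
          apply mul_le_mul_of_nonneg_right _ (by positivity)
          exact pow_le_pow_left₀ (by norm_num) hb3 n
      _ = 3 ^ n * b ^ n := mul_comm _ _
  -- `3 (n + 3) ≤ 9ⁿ` (Bernoulli) and `27ⁿ ≤ e^{4n} ≤ log log T`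
  have h9 : 3 * ((n : ℝ) + 3) ≤ (9 : ℝ) ^ n := by
    have hB := one_add_mul_le_pow (by norm_num : (-2 : ℝ) ≤ 8) n
    have h1n : (1 : ℝ) ≤ n := by linarith
    norm_num at hB
    linarith
  have h27 : (27 : ℝ) ^ n ≤ Real.log (Real.log T) := by
    calc (27 : ℝ) ^ n ≤ (Real.exp 4) ^ n := pow_le_pow_left₀ (by norm_num) twentySeven_le_exp_four n
      _ = Real.exp (4 * n) := by rw [← Real.exp_nat_mul]; ring_nf
      _ ≤ Real.exp L₃ := Real.exp_le_exp.2 (by linarith)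
      _ = Real.log (Real.log T) := by rw [hL₃def, Real.exp_log hL2pos]
  have hexp : 1 / b ^ n * Real.log C ≤ Real.log (Real.log T) := by
    have hlogC0 : 0 ≤ Real.log C := Real.log_nonneg hC1
    calc 1 / b ^ n * Real.log C ≤ (3 : ℝ) ^ n * (3 * (n + 3)) :=
          mul_le_mul hinv hlogC hlogC0 (by positivity)
      _ ≤ (3 : ℝ) ^ n * 9 ^ n := mul_le_mul_of_nonneg_left h9 (by positivity)
      _ = 27 ^ n := by rw [← mul_pow]; norm_num
      _ ≤ Real.log (Real.log T) := h27
  have hC : C ^ (1 / b ^ n) ≤ Real.log T := by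
    rw [Real.rpow_def_of_pos hC0, ← Real.exp_log hL1pos]
    exact Real.exp_le_exp.2 (by rw [mul_comm]; exact hexp)
  -- apply the parametric step and convert `14/n ≤ 112/L₃`
  rw [hCdef, hbdef] at hC
  obtain ⟨ρ, h0, him, h1, h2⟩ := exists_zero_im_near_of_rpow_le_log hn28 hT8 h21 hC
  refine ⟨ρ, h0, him.trans ?_, h1, h2⟩
  rw [← hL₃def, div_le_div_iff₀ hn0 (by linarith)]
  nlinarith

end LittlewoodZeroGaps

/-- **Littlewood's theorem, Titchmarsh Thm 9.12 as printed** («for every large positive `T`, `ζ(s)` has a zero `β + iγ`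
satisfying `|γ − T| < A / log log log T`»), with `A = 112` and zeros taken in the tree's set of non-trivial zeros.
[cite: Titchmarsh1986, Thm 9.12] -/
theorem littlewood_zero_near_every_height :
    ∃ T₀ : ℝ, ∀ T : ℝ, T₀ ≤ T →
      ∃ ρ ∈ ZetaZeros.riemannZetaNontrivialZeros, |ρ.im - T| ≤ 112 / Real.log (Real.log (Real.log T)) := by
  obtain ⟨T₀, hT₀⟩ := LittlewoodZeroGaps.exists_zero_im_near_logloglog
  refine ⟨T₀, fun T hT ↦ ?_⟩
  obtain ⟨ρ, h0, him, h1, h2⟩ := hT₀ T hT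
  exact ⟨ρ, mem_riemannZetaNontrivialZeros_iff_holds.2 ⟨h0, h1, h2⟩, him⟩

end Literature.NumberTheory.LFunctions

end
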